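/- WIDTH seat `ym-line-cbag-p1-w2` (prover-ym-line-cbag-p1-w2-g22-0; own items stmt-QuantumFields-22254 / 22893 CLOSED·proved), LINE 7
`GlueballBandRecursion`, in support of ⟨stmt-QuantumFields-22957⟩ `OneParticleBlochSymbolFamily` (= `Band.EffectiveBlochSymbolFamily`):
capstone of the glue door «QUASI-BAND ⇒ ISOLATED BAND» (parts 1–2: `…QuasiBandIsolation`, `…QuasiBandIsolationTransfer`) composed with the
width seat w3's covariant Löwdin orthonormalisation (`…CovariantFrame`): the SPECTRAL CLAUSES of the LEAD's stub `Band.IsolatedBandFrame`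
from quasi-band data.  Route-independent; definition-free; a helper. -/
import Summits.QuantumFields.YangMills.Theorems.GlueballBandRecursionQuasiBandIsolationTransfer
import Summits.QuantumFields.YangMills.Theorems.GlueballBandRecursionCovariantFrame

/-!
# Route `GlueballBandRecursion`, item `OneParticleBlochSymbolFamily` (stmt-QuantumFields-22957): the covariant frame and the band
# eigenbasis of the LEAD's stub `IsolatedBandFrame` from a quasi-band

The one registered stub of LINE 7, `Band.IsolatedBandFrame` (Theorems/GlueballBandRecursionIsolatedBandDefs.lean), asks per `β` on the window
and `N ≥ L₀` for: a translation-covariant ORTHONORMAL frame `ψ : (ℤ/N)³ × Fin n → L²` spanning a `𝕋`-invariant subspace, an orthonormal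
EIGENBASIS `e`, `μ` of the same span, a band floor/ceiling `q_min λ₊ ≤ μ_k < λ₊` and ISOLATION (`𝕋 v = l v`, `v ⊥ e ⇒ v = 0 ∨ l = λ₊ ∨
l ≤ δ q_min λ₊`) — plus kernel bounds, band-top stability and a dilute anchor.  A cluster expansion does not diagonalise `𝕋`; it produces
dressed local excitations.  `isolatedBand_spectralClauses_of_quasiBand` shows that the first two clause blocks follow from QUASI-BAND data
alone: a covariant LINEARLY INDEPENDENT family `φ : (ℤ/N)³ × Fin n → L²` orthogonal to the ground state `Ω`, a Rayleigh floor `a` on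
`V = span φ`, a Rayleigh ceiling `θ` and a coupling `ε` on `Vᗮ ∩ Ωᗮ`, and the gap `θ + 2ε < a` (output: `a − ε ≤ μ_k < λ₊`, isolation
threshold `θ + ε`; the stub's currency is `q_min := (a − ε)/λ₊`, `δ := (θ + ε)/(a − ε) < 1`).  Chain: `exists_isolatedBand_of_quasiBand`
(exact band `e`, window count, invariance) → `projected_quasiBand_frame` (`P_W φ` covariant, independent, spanning `W = span e`) →
w3's `exists_orthonormal_covariant_frame` (Löwdin).

HONEST FRAMING.  Conditional plumbing for the XL item ⟨stmt-QuantumFields-22957⟩ of a strong-coupling RECORD-rung line; the kernel bounds,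
the anchor and the volume stability of the stub — and the quasi-band bounds themselves — remain the cluster expansion's (not in print on the
periodic torus).  Neither the item, nor the rung `ColdDoublingRecursionStrongCoupling`, nor the Yang–Mills mass gap / the summit `YangMills`
is proved or advanced here.
-/

set_option autoImplicit false

noncomputable section

open scoped InnerProductSpace BigOperators
open MeasureTheory
open Literature.MathematicalPhysics.QuantumFieldTheory

namespace Summit.QuantumFields.YangMills.Theorems.GlueballBandRecursion.Band

variable {G : Type} [Group G] [TopologicalSpace G] [IsTopologicalGroup G] [CompactSpace G]
  [MeasurableSpace G] [BorelSpace G]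

/-- **The spectral clauses of `IsolatedBandFrame` from a quasi-band.**  Data: `β ≥ 0`, rate `q_N < 1`, a ground state `Ω ≠ 0`
(`𝕋 Ω = λ₊ Ω`), a translation-covariant linearly independent family `φ : (ℤ/N)³ × Fin n → L²` with `φ_a ⊥ Ω` (the dressed one-plaquette
excitations), and on `V = span φ`: floor `a‖v‖² ≤ ⟪v, 𝕋 v⟫`; on `Vᗮ ∩ Ωᗮ`: ceiling `⟪w, 𝕋 w⟫ ≤ θ‖w‖²` and coupling
`|⟪w, 𝕋 v⟫| ≤ ε‖v‖‖w‖` (`θ, ε ≥ 0`); gap `θ + 2ε < a`.  Conclusion (same index `(ℤ/N)³ × Fin n`): an orthonormal covariant frame `ψ`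
with `𝕋`-invariant span, an orthonormal eigenbasis `e`, `μ` of that span (`e_k ∈ span ψ`, `ψ_a ∈ span e`, `span ψ = span e`), the band
floor/ceiling `a − ε ≤ μ_k < λ₊`, and isolation: `𝕋 v = l v`, `v ⊥ e_k ∀ k ⇒ v = 0 ∨ l = λ₊ ∨ l ≤ θ + ε`. -/
theorem isolatedBand_spectralClauses_of_quasiBand (r : LatticeRep G) {β : ℝ} (hβ : 0 ≤ β) (N : ℕ) [NeZero N]
    (hq : (⨅ k : ℕ, traceExcess r.ρ β N (k + 2) ^ ((1 : ℝ) / ((k : ℝ) + 2))) < 1)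
    {Ω : Lp ℝ 2 (Measure.pi fun _ : Edge 3 N => haarProbability G)} (hΩ0 : Ω ≠ 0)
    (hΩ : wilsonTorusTransferMatrix r.ρ β N Ω = transferSpectralRadius r.ρ β N • Ω)
    {a θ ε : ℝ} (hθ : 0 ≤ θ) (hε : 0 ≤ ε) (hgap : θ + 2 * ε < a)
    {n : ℕ} {φ : Site 3 N × Fin n → Lp ℝ 2 (Measure.pi fun _ : Edge 3 N => haarProbability G)}
    (hφ : LinearIndependent ℝ φ)
    (hcovφ : ∀ (v x : Site 3 N) (j : Fin n), φ (v + x, j) = koopmanTranslate N v (φ (x, j)))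
    (hΩφ : ∀ a', ⟪Ω, φ a'⟫_ℝ = 0)
    (hV : ∀ v ∈ Submodule.span ℝ (Set.range φ), a * ‖v‖ ^ 2 ≤ ⟪v, wilsonTorusTransferMatrix r.ρ β N v⟫_ℝ)
    (hVp : ∀ w ∈ (Submodule.span ℝ (Set.range φ))ᗮ, ⟪Ω, w⟫_ℝ = 0 →
      ⟪w, wilsonTorusTransferMatrix r.ρ β N w⟫_ℝ ≤ θ * ‖w‖ ^ 2)
    (hcross : ∀ v ∈ Submodule.span ℝ (Set.range φ), ∀ w ∈ (Submodule.span ℝ (Set.range φ))ᗮ, ⟪Ω, w⟫_ℝ = 0 →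
      |⟪w, wilsonTorusTransferMatrix r.ρ β N v⟫_ℝ| ≤ ε * ‖v‖ * ‖w‖) :
    ∃ (ψ e : Site 3 N × Fin n → Lp ℝ 2 (Measure.pi fun _ : Edge 3 N => haarProbability G)) (μ : Site 3 N × Fin n → ℝ),
      Orthonormal ℝ ψ ∧
      (∀ (v x : Site 3 N) (j : Fin n), ψ (v + x, j) = koopmanTranslate N v (ψ (x, j))) ∧
      (∀ b, wilsonTorusTransferMatrix r.ρ β N (ψ b) ∈ Submodule.span ℝ (Set.range ψ)) ∧
      Orthonormal ℝ e ∧ (∀ k, wilsonTorusTransferMatrix r.ρ β N (e k) = μ k • e k) ∧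
      (∀ k, e k ∈ Submodule.span ℝ (Set.range ψ)) ∧ (∀ a', ψ a' ∈ Submodule.span ℝ (Set.range e)) ∧
      Submodule.span ℝ (Set.range ψ) = Submodule.span ℝ (Set.range e) ∧
      (∀ k, a - ε ≤ μ k) ∧ (∀ k, μ k < transferSpectralRadius r.ρ β N) ∧
      (∀ (v : Lp ℝ 2 (Measure.pi fun _ : Edge 3 N => haarProbability G)) (l : ℝ),
        wilsonTorusTransferMatrix r.ρ β N v = l • v → (∀ k, ⟪e k, v⟫_ℝ = 0) →
        v = 0 ∨ l = transferSpectralRadius r.ρ β N ∨ l ≤ θ + ε) := by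
  classical
  haveI : FiniteDimensional ℝ (Submodule.span ℝ (Set.range φ)) := Module.Finite.span_of_finite ℝ (Set.finite_range φ)
  -- `V = span φ ⊥ Ω`
  have hV0 : ∀ v ∈ Submodule.span ℝ (Set.range φ), ⟪Ω, v⟫_ℝ = 0 := by
    intro v hv
    have hle : Submodule.span ℝ (Set.range φ) ≤ (ℝ ∙ Ω)ᗮ :=
      Submodule.span_le.2 (Set.range_subset_iff.2 fun a' =>
        (Submodule.mem_orthogonal_singleton_iff_inner_right).2 (hΩφ a'))
    exact (Submodule.mem_orthogonal_singleton_iff_inner_right).1 (hle hv)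
  have hκ : Fintype.card (Site 3 N × Fin n) = Module.finrank ℝ (Submodule.span ℝ (Set.range φ)) :=
    (finrank_span_eq_card hφ).symm
  obtain ⟨e, μ, he, hμ, hband, hiso, hsee, hinvar⟩ := exists_isolatedBand_of_quasiBand r hβ N hq
    (Submodule.span ℝ (Set.range φ)) hΩ0 hΩ hθ hε hgap hV0 hV hVp hcross (Site 3 N × Fin n) hκ
  -- the band space `W = span e`: finite-dimensional, complete, translation invariant, `𝕋`-invariant
  haveI : FiniteDimensional ℝ (Submodule.span ℝ (Set.range e)) := Module.Finite.span_of_finite ℝ (Set.finite_range e)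
  haveI : CompleteSpace (Submodule.span ℝ (Set.range e)) := FiniteDimensional.complete ℝ _
  have hWkoop : ∀ (v : Site 3 N), ∀ x ∈ Submodule.span ℝ (Set.range e),
      koopmanTranslate N v x ∈ Submodule.span ℝ (Set.range e) := fun v x hx =>
    hinvar (Lp.compMeasurePreservingₗᵢ ℝ (configTranslate (G := G) v)
        (measurePreserving_configTranslate v (haarProbability G))).toLinearMap
      (fun y => koopmanTranslate_transfer_comm r β N v y) x hx
  have hWT : ∀ x ∈ Submodule.span ℝ (Set.range e),
      wilsonTorusTransferMatrix r.ρ β N x ∈ Submodule.span ℝ (Set.range e) := fun x hx =>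
    hinvar (wilsonTorusTransferMatrix r.ρ β N : _ →ₗ[ℝ] _) (fun y => rfl) x hx
  -- project the quasi-band frame onto the band: covariant, independent, spanning `W`
  obtain ⟨hli, hcov1, hspan1⟩ := projected_quasiBand_frame N he (Submodule.span ℝ (Set.range φ)) hsee hWkoop hφ
    (fun a' => Submodule.subset_span ⟨a', rfl⟩) hcovφ rfl
  have hinv1 : ∀ b, wilsonTorusTransferMatrix r.ρ β N ((Submodule.span ℝ (Set.range e)).starProjection (φ b)) ∈
      Submodule.span ℝ (Set.range fun a' => (Submodule.span ℝ (Set.range e)).starProjection (φ a')) := fun b => by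
    rw [hspan1]
    exact hWT _ (Submodule.starProjection_apply_mem _ _)
  -- Löwdin (w3): an orthonormal covariant frame of the same span
  obtain ⟨ψ, hψ, hψcov, hψinv, hψspan⟩ := exists_orthonormal_covariant_frame r β N
    (fun a' => (Submodule.span ℝ (Set.range e)).starProjection (φ a')) hli hcov1 hinv1
  have hspanψ : Submodule.span ℝ (Set.range ψ) = Submodule.span ℝ (Set.range e) := hψspan.trans hspan1
  refine ⟨ψ, e, μ, hψ, hψcov, hψinv, he, hμ, fun k => ?_, fun a' => ?_, hspanψ, fun k => (hband k).1,
    fun k => (hband k).2, hiso⟩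
  · rw [hspanψ]
    exact Submodule.subset_span ⟨k, rfl⟩
  · rw [← hspanψ]
    exact Submodule.subset_span ⟨a', rfl⟩

end Summit.QuantumFields.YangMills.Theorems.GlueballBandRecursion.Band

end
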